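import Summits.QuantumFields.YangMills.Theorems.FluctuationComparisonRegPrIntLOrganTangentLawEdgeResponse
import HarnessLib

/-!
# Crux `FluctuationComparisonRegPrIntL` (stmt-QuantumFields-20520, rung R3), PATH-B organ, H-currency cone — (L24) «LAW-SQUARE RESPONSE = PATH MIXED SECOND
# DERIVATIVE»: the second-order (two law edges) companion of ✓(L23) `…OrganTangentLawEdgeResponse`, Mathlib-only

Cell `ym3-torus` (YM ladder rung R3 = continuum `SU(2)` Yang–Mills on the three-torus — a RUNG: NOT d = 4, NOT infinite volume, NOT a mass gap, NOT Clay).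
Width seat `ym-ust-20520-w5` (gen 24), `--supports stmt-QuantumFields-20520 --as helper`, count-neutral, no registry ∕ binder ∕ `Lines/` edit, DEFINITION-FREE,
default heartbeats.  Imports ✓(L23) (hence Mathlib's parametric-integral ∕ mean-value files) + HarnessLib ONLY — reusable outside this cell.

WHY.  The LAW SQUARES of the rows `SpreadFibreLawH` ∕ `SpreadFibreLawHJ` — (L2ʲ-h) `E_{V11}[F] − E_{V10}[F] − E_{V01}[F] + E_{V00}[F]` and (JV4-h′) the same second
difference of the own-centred VARIANCE of `F = h_Ts∘Φ(V00,·)` — move the law point over a coarse one-bond SQUARE `X(s,s′) = V00·expPt(s•m)@B·expPt(s′•m′)@B′`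
with the integrand frozen; `w s s′ z := wNum … t (X(s,s′)) z` is a TWO-parameter `τ`-density family, nonlinear in both parameters.  This file: §1 the calculus
core on `[0,1]²` — ★`abs_secondDiff_le_of_mixedDeriv` (`|φ 1 1 − φ 1 0 − φ 0 1 + φ 0 0| ≤ sup_{[0,1]²} |∂₁∂₂φ|`, two mean-value steps over ✓(L23)
`abs_sub_le_of_hasDerivAt_of_abs_le`) and `hasDerivAt_mul_self_mixed` (`∂₁∂₂(φ²) = 2(∂₁φ·∂₂φ + φ·∂₁∂₂φ)`, for the variance); §2 ★★`hasDerivAt_normMean_partial`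
— the `s`-derivative AT `s₀` of the `s′`-response `s ↦ (∫ G·∂₂w(s,s′₀))∕Z(s,s′₀) − E(s,s′₀)[G]·(∫ ∂₂w(s,s′₀))∕Z(s,s′₀)` (✓(L23) `hasDerivAt_normMean`'s value, now
differentiated in the OTHER parameter: dominated differentiation of `∫ G·∂₂w` and `∫ ∂₂w` with the mixed family `∂₁∂₂w`, quotient and product rules), value in
closed «N-form» `(N₁₂(G) − N₂(G)·N₁(1)) − ((N₁(G) − E(G)·N₁(1))·N₂(1) + E(G)·(N₁₂(1) − N₂(1)·N₁(1)))`, `E(G) = ∫G·w∕Z`, `Nᵢ(G) = ∫G·∂ᵢw∕Z`, `N₁₂(G) = ∫G·∂₁∂₂w∕Z`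
— in score language `κ₃(G, r₁, r₂) + Cov(G, ∂₁r₂)`, `rᵢ = ∂ᵢw∕w`; `normMean_deriv_eq_cov_of_null` = ✓(L23)'s score reading under the WEAKER «`w′ = 0` where `w = 0`» (CUT
weights vanish off the multi-window); §3 ★★`abs_normMean_secondDiff_le` — §1 + §2 on an open `U ⊇ [0,1]` (both parameters): a uniform bound
`ℓ` of the N-form on `[0,1]²` bounds the law square of the frozen-integrand mean (the (L2ʲ-h) shape).  The (JV4-h′) variance square follows from §1's
`hasDerivAt_mul_self_mixed` with ✓(L23) `integral_centred_mul_eq` (own-centred variance = `E[F²] − E[F]²`) — stated as ★`abs_secondDiff_sq_le` at the calculus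
level (inputs: the first and mixed partials of `E[F]` and the mixed partial of `E[F²]`).

HONEST FRAMING: generic dominated-differentiation ∕ quotient-rule ∕ mean-value plumbing [folklore]; no letter is priced, no cumulant is bounded, no score computed;
nothing of Bałaban's analysis is asserted or proved; `SpreadFibreLawH` ∕ `SpreadFibreLawHJ` are HYPOTHESIS rows; LIN″ ∕ JVAR″ ∕ JEN″ ∕ O1ᵘ-H v2.2 ∕ S1aᴴ ∕ S3ᴴ ∕ S2α′ ∕
S2β, the five registered stubs of `Lines/semiclassical_s2beta.lean`, crux 20520 `FluctuationComparisonRegPrIntL` and `YM3TorusSU2` are NOT proved; registry untouched;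
rung R3 = SU(2) YM₃ on T³ at fixed lattice data — NOT d = 4, NOT infinite volume, NOT a mass gap, NOT Clay; the Yang–Mills mass gap is NOT proved.  [folklore].
-/

set_option autoImplicit false

noncomputable section

namespace Summit.QuantumFields.YangMills.Theorems.OrganTangentLawSquareResponse

open MeasureTheory Filter Topology Set
open scoped ENNReal
open Summit.QuantumFields.YangMills.Theorems.OrganTangentLawEdgeResponse

/-! ## §1 Calculus core on `[0,1]²` -/

/-- ★ **SECOND DIFFERENCE ≤ sup OF THE MIXED PARTIAL** on `[0,1]²`: if `s′ ↦ φ s s′` has derivative `φ₂ s s′` (for `s ∈ {0, 1}` suffices; asked on `[0,1]`),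
`s ↦ φ₂ s s′` has derivative `φ₁₂ s s′`, and `|φ₁₂| ≤ ℓ` on `[0,1]²`, then `|φ 1 1 − φ 1 0 − φ 0 1 + φ 0 0| ≤ ℓ` (two mean-value steps). [folklore] -/
theorem abs_secondDiff_le_of_mixedDeriv {φ φ₂ φ₁₂ : ℝ → ℝ → ℝ} {ℓ : ℝ}
    (h2 : ∀ s ∈ Icc (0:ℝ) 1, ∀ s' ∈ Icc (0:ℝ) 1, HasDerivAt (fun s' => φ s s') (φ₂ s s') s')
    (h12 : ∀ s ∈ Icc (0:ℝ) 1, ∀ s' ∈ Icc (0:ℝ) 1, HasDerivAt (fun s => φ₂ s s') (φ₁₂ s s') s)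
    (hb : ∀ s ∈ Icc (0:ℝ) 1, ∀ s' ∈ Icc (0:ℝ) 1, |φ₁₂ s s'| ≤ ℓ) :
    |φ 1 1 - φ 1 0 - φ 0 1 + φ 0 0| ≤ ℓ := by
  have h1mem : (1:ℝ) ∈ Icc (0:ℝ) 1 := ⟨zero_le_one, le_rfl⟩
  have h0mem : (0:ℝ) ∈ Icc (0:ℝ) 1 := ⟨le_rfl, zero_le_one⟩
  have hg : ∀ s' ∈ Icc (0:ℝ) 1, HasDerivAt (fun s' => φ 1 s' - φ 0 s') (φ₂ 1 s' - φ₂ 0 s') s' :=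
    fun s' hs' => (h2 1 h1mem s' hs').sub (h2 0 h0mem s' hs')
  have hgb : ∀ s' ∈ Icc (0:ℝ) 1, |φ₂ 1 s' - φ₂ 0 s'| ≤ ℓ := fun s' hs' =>
    abs_sub_le_of_hasDerivAt_of_abs_le (f := fun s => φ₂ s s') (fun s hs => h12 s hs s' hs') (fun s hs => hb s hs s' hs')
  have h := abs_sub_le_of_hasDerivAt_of_abs_le (f := fun s' => φ 1 s' - φ 0 s') hg hgb
  have e : φ 1 1 - φ 0 1 - (φ 1 0 - φ 0 0) = φ 1 1 - φ 1 0 - φ 0 1 + φ 0 0 := by ring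
  rwa [e] at h

/-- `∂₁∂₂(φ²) = 2·(∂₁φ·∂₂φ + φ·∂₁∂₂φ)`: if `s ↦ φ s s′₀` has derivative `a` at `s₀`, `s ↦ φ₂ s s′₀` (the `s′`-partial) has derivative `c` at `s₀`, then the
`s′`-partial of `φ²`, namely `s ↦ 2·φ s s′₀·φ₂ s s′₀`, has derivative `2·(a·φ₂ s₀ s′₀ + φ s₀ s′₀·c)` at `s₀` (product rule; for the VARIANCE square (JV4-h′)). [folklore] -/
theorem hasDerivAt_mul_self_mixed {φ φ₂ : ℝ → ℝ → ℝ} {a c s₀ s'₀ : ℝ}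
    (h1 : HasDerivAt (fun s => φ s s'₀) a s₀) (h12 : HasDerivAt (fun s => φ₂ s s'₀) c s₀) :
    HasDerivAt (fun s => 2 * (φ s s'₀ * φ₂ s s'₀)) (2 * (a * φ₂ s₀ s'₀ + φ s₀ s'₀ * c)) s₀ :=
  (h1.mul h12).const_mul 2

/-- `∂₂(φ²) = 2·φ·∂₂φ` (chain rule), the `s′`-partial fed to `hasDerivAt_mul_self_mixed`. [folklore] -/
theorem hasDerivAt_mul_self_partial {φ φ₂ : ℝ → ℝ → ℝ} {s₀ s'₀ : ℝ}
    (h2 : HasDerivAt (fun s' => φ s₀ s') (φ₂ s₀ s'₀) s'₀) :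
    HasDerivAt (fun s' => φ s₀ s' * φ s₀ s') (2 * (φ s₀ s'₀ * φ₂ s₀ s'₀)) s'₀ := by
  refine (h2.mul h2).congr_deriv ?_
  ring

/-- ★ **THE VARIANCE SQUARE AT THE CALCULUS LEVEL** (the (JV4-h′) shape, uncentred variance `ψ − φ²` with `ψ = E[F²]`, `φ = E[F]`): from the `s′`-partials of
`ψ` and `φ`, their `s`-derivatives (mixed partials `ψ₁₂`, `φ₁₂`) and the `s`-partial `φ₁` on `[0,1]²`, a uniform bound
`|ψ₁₂ − 2(φ₁·φ₂ + φ·φ₁₂)| ≤ ℓ` gives `|ΔΔ (ψ − φ²)| ≤ ℓ`. [folklore] -/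
theorem abs_secondDiff_var_le {ψ ψ₂ ψ₁₂ φ φ₁ φ₂ φ₁₂ : ℝ → ℝ → ℝ} {ℓ : ℝ}
    (hψ2 : ∀ s ∈ Icc (0:ℝ) 1, ∀ s' ∈ Icc (0:ℝ) 1, HasDerivAt (fun s' => ψ s s') (ψ₂ s s') s')
    (hψ12 : ∀ s ∈ Icc (0:ℝ) 1, ∀ s' ∈ Icc (0:ℝ) 1, HasDerivAt (fun s => ψ₂ s s') (ψ₁₂ s s') s)
    (hφ1 : ∀ s ∈ Icc (0:ℝ) 1, ∀ s' ∈ Icc (0:ℝ) 1, HasDerivAt (fun s => φ s s') (φ₁ s s') s)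
    (hφ2 : ∀ s ∈ Icc (0:ℝ) 1, ∀ s' ∈ Icc (0:ℝ) 1, HasDerivAt (fun s' => φ s s') (φ₂ s s') s')
    (hφ12 : ∀ s ∈ Icc (0:ℝ) 1, ∀ s' ∈ Icc (0:ℝ) 1, HasDerivAt (fun s => φ₂ s s') (φ₁₂ s s') s)
    (hb : ∀ s ∈ Icc (0:ℝ) 1, ∀ s' ∈ Icc (0:ℝ) 1, |ψ₁₂ s s' - 2 * (φ₁ s s' * φ₂ s s' + φ s s' * φ₁₂ s s')| ≤ ℓ) :
    |(ψ 1 1 - φ 1 1 * φ 1 1) - (ψ 1 0 - φ 1 0 * φ 1 0) - (ψ 0 1 - φ 0 1 * φ 0 1) + (ψ 0 0 - φ 0 0 * φ 0 0)| ≤ ℓ :=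
  abs_secondDiff_le_of_mixedDeriv (φ := fun s s' => ψ s s' - φ s s' * φ s s')
    (φ₂ := fun s s' => ψ₂ s s' - 2 * (φ s s' * φ₂ s s')) (φ₁₂ := fun s s' => ψ₁₂ s s' - 2 * (φ₁ s s' * φ₂ s s' + φ s s' * φ₁₂ s s'))
    (fun s hs s' hs' => (hψ2 s hs s' hs').sub (hasDerivAt_mul_self_partial (hφ2 s hs s' hs')))
    (fun s hs s' hs' => (hψ12 s hs s' hs').sub (hasDerivAt_mul_self_mixed (hφ1 s hs s' hs') (hφ12 s hs s' hs'))) hb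


/-! ## §2 The mixed second derivative of a frozen-integrand mean (abstract carrier `(Z, τ)`) -/

section Abstract

variable {Z : Type*} [MeasurableSpace Z] {τ : Measure Z}

/-- Quotient rule in «N-form»: `(P∕Zf)′ = P′∕Zf − (P∕Zf)·(Zf′∕Zf)` at `s₀`, `Zf s₀ ≠ 0`. [folklore] -/
theorem hasDerivAt_div_normForm {P Zf : ℝ → ℝ} {p z' s₀ : ℝ} (hP : HasDerivAt P p s₀) (hZ : HasDerivAt Zf z' s₀) (h0 : Zf s₀ ≠ 0) :
    HasDerivAt (fun s => P s / Zf s) (p / Zf s₀ - (P s₀ / Zf s₀) * (z' / Zf s₀)) s₀ := by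
  have heq : (p * Zf s₀ - P s₀ * z') / Zf s₀ ^ 2 = p / Zf s₀ - (P s₀ / Zf s₀) * (z' / Zf s₀) := by
    field_simp
  rw [← heq]
  exact hP.div hZ h0

/-- ★★ **THE `s`-DERIVATIVE OF AN `s′`-RESPONSE** (mixed second derivative of a frozen-integrand mean, abstract form).  Data at `s₀` on a neighbourhood `S ∈ 𝓝 s₀`:
a density family `v` (think `s ↦ w(s, s′₀)`) with `s`-derivative `v₁`, a second family `u` (think `s ↦ ∂₂w(s, s′₀)`) with `s`-derivative `u₁` (think `∂₁∂₂w`),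
a frozen factor `G`, a.e. dominators of `v₁`, `G·v₁`, `u₁`, `G·u₁` on `S`, integrability of `v s₀`, `G·v s₀`, `u s₀`, `G·u s₀`, and `Z := ∫ v s₀ ≠ 0`.  Then the
`s′`-response `s ↦ (∫ G·u s)∕(∫ v s) − ((∫ G·v s)∕(∫ v s))·((∫ u s)∕(∫ v s))` (✓(L23) `hasDerivAt_normMean`'s value with `u = ∂₂w`) has `s`-derivative
`(N₁₂(G) − N₂(G)·N₁(1)) − ((N₁(G) − E(G)·N₁(1))·N₂(1) + E(G)·(N₁₂(1) − N₂(1)·N₁(1)))` with `E(G) = ∫G·v∕Z`, `N₁(G) = ∫G·v₁∕Z`, `N₂(G) = ∫G·u∕Z`, `N₁₂(G) = ∫G·u₁∕Z`,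
`N₁(1) = ∫v₁∕Z`, `N₂(1) = ∫u∕Z`, `N₁₂(1) = ∫u₁∕Z` (all at `s₀`) — in score language `κ₃(G, r₁, r₂) + Cov(G, ∂₁r₂)`. [folklore] -/
theorem hasDerivAt_response_family {v v₁ u u₁ : ℝ → Z → ℝ} {G : Z → ℝ} {s₀ : ℝ} {S : Set ℝ} (hS : S ∈ 𝓝 s₀)
    (hG : AEStronglyMeasurable G τ) (hvm : ∀ s, AEStronglyMeasurable (v s) τ) (hum : ∀ s, AEStronglyMeasurable (u s) τ)
    (hv₁m : AEStronglyMeasurable (v₁ s₀) τ) (hu₁m : AEStronglyMeasurable (u₁ s₀) τ)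
    (hvi : Integrable (v s₀) τ) (hGvi : Integrable (fun z => G z * v s₀ z) τ)
    (hui : Integrable (u s₀) τ) (hGui : Integrable (fun z => G z * u s₀ z) τ)
    {b₁ : Z → ℝ} (hb₁ : ∀ᵐ z ∂τ, ∀ s ∈ S, |v₁ s z| ≤ b₁ z) (hb₁i : Integrable b₁ τ)
    {b₁G : Z → ℝ} (hb₁G : ∀ᵐ z ∂τ, ∀ s ∈ S, |G z * v₁ s z| ≤ b₁G z) (hb₁Gi : Integrable b₁G τ)
    {c₁ : Z → ℝ} (hc₁ : ∀ᵐ z ∂τ, ∀ s ∈ S, |u₁ s z| ≤ c₁ z) (hc₁i : Integrable c₁ τ)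
    {c₁G : Z → ℝ} (hc₁G : ∀ᵐ z ∂τ, ∀ s ∈ S, |G z * u₁ s z| ≤ c₁G z) (hc₁Gi : Integrable c₁G τ)
    (hvd : ∀ᵐ z ∂τ, ∀ s ∈ S, HasDerivAt (fun s => v s z) (v₁ s z) s)
    (hud : ∀ᵐ z ∂τ, ∀ s ∈ S, HasDerivAt (fun s => u s z) (u₁ s z) s)
    (hZ : ∫ z, v s₀ z ∂τ ≠ 0) :
    HasDerivAt (fun s => (∫ z, G z * u s z ∂τ) / (∫ z, v s z ∂τ)
        - ((∫ z, G z * v s z ∂τ) / (∫ z, v s z ∂τ)) * ((∫ z, u s z ∂τ) / (∫ z, v s z ∂τ)))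
      (((∫ z, G z * u₁ s₀ z ∂τ) / (∫ z, v s₀ z ∂τ)
          - ((∫ z, G z * u s₀ z ∂τ) / (∫ z, v s₀ z ∂τ)) * ((∫ z, v₁ s₀ z ∂τ) / (∫ z, v s₀ z ∂τ)))
        - ((((∫ z, G z * v₁ s₀ z ∂τ) / (∫ z, v s₀ z ∂τ)
              - ((∫ z, G z * v s₀ z ∂τ) / (∫ z, v s₀ z ∂τ)) * ((∫ z, v₁ s₀ z ∂τ) / (∫ z, v s₀ z ∂τ)))
            * ((∫ z, u s₀ z ∂τ) / (∫ z, v s₀ z ∂τ)))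
          + ((∫ z, G z * v s₀ z ∂τ) / (∫ z, v s₀ z ∂τ))
            * ((∫ z, u₁ s₀ z ∂τ) / (∫ z, v s₀ z ∂τ)
              - ((∫ z, u s₀ z ∂τ) / (∫ z, v s₀ z ∂τ)) * ((∫ z, v₁ s₀ z ∂τ) / (∫ z, v s₀ z ∂τ))))) s₀ := by
  have hZ' : HasDerivAt (fun s => ∫ z, v s z ∂τ) (∫ z, v₁ s₀ z ∂τ) s₀ :=
    hasDerivAt_integral_family hS hvm hvi hv₁m hb₁ hb₁i hvd
  have hP : HasDerivAt (fun s => ∫ z, G z * u s z ∂τ) (∫ z, G z * u₁ s₀ z ∂τ) s₀ :=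
    hasDerivAt_integral_mul_family hS hG hum hGui hu₁m hc₁G hc₁Gi hud
  have hQ : HasDerivAt (fun s => ∫ z, G z * v s z ∂τ) (∫ z, G z * v₁ s₀ z ∂τ) s₀ :=
    hasDerivAt_integral_mul_family hS hG hvm hGvi hv₁m hb₁G hb₁Gi hvd
  have hM : HasDerivAt (fun s => ∫ z, u s z ∂τ) (∫ z, u₁ s₀ z ∂τ) s₀ :=
    hasDerivAt_integral_family hS hum hui hu₁m hc₁ hc₁i hud
  exact (hasDerivAt_div_normForm hP hZ' hZ).sub ((hasDerivAt_div_normForm hQ hZ' hZ).mul (hasDerivAt_div_normForm hM hZ' hZ))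

/-- (Addendum to ✓(L23) `normMean_deriv_eq_cov` for CUT weights.)  The covariance ∕ score reading of the law response needs only «`w′_{s₀} = 0` wherever `w_{s₀} = 0`»
(a.e.) instead of `w_{s₀} ≠ 0` a.e. — the case of the organ's soft-cut weights `wNum = χ·ρ^t·ρ′^{1−t}·J`, which VANISH off the multi-window (a non-negative differentiable
family has zero derivative on its zero set); with Lean's `x ∕ 0 = 0` the score `r = w′∕w` is `0` there and both sides agree pointwise. [folklore] -/
theorem normMean_deriv_eq_cov_of_null {w w' : ℝ → Z → ℝ} {G : Z → ℝ} {s₀ : ℝ} (hw : ∀ᵐ z ∂τ, w s₀ z = 0 → w' s₀ z = 0) :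
    (∫ z, G z * w' s₀ z ∂τ) / (∫ z, w s₀ z ∂τ)
        - ((∫ z, G z * w s₀ z ∂τ) / (∫ z, w s₀ z ∂τ)) * ((∫ z, w' s₀ z ∂τ) / (∫ z, w s₀ z ∂τ))
      = (∫ z, G z * (w' s₀ z / w s₀ z) * (w s₀ z / ∫ z', w s₀ z' ∂τ) ∂τ)
        - (∫ z, G z * (w s₀ z / ∫ z', w s₀ z' ∂τ) ∂τ) * (∫ z, (w' s₀ z / w s₀ z) * (w s₀ z / ∫ z', w s₀ z' ∂τ) ∂τ) := by
  have h1 : (∫ z, G z * (w' s₀ z / w s₀ z) * (w s₀ z / ∫ z', w s₀ z' ∂τ) ∂τ)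
      = (∫ z, G z * w' s₀ z ∂τ) / (∫ z, w s₀ z ∂τ) := by
    rw [← integral_div]
    refine integral_congr_ae ?_
    filter_upwards [hw] with z hz
    by_cases h0 : w s₀ z = 0
    · rw [h0, hz h0]; simp
    · field_simp
  have h3 : (∫ z, (w' s₀ z / w s₀ z) * (w s₀ z / ∫ z', w s₀ z' ∂τ) ∂τ) = (∫ z, w' s₀ z ∂τ) / (∫ z, w s₀ z ∂τ) := by
    rw [← integral_div]
    refine integral_congr_ae ?_
    filter_upwards [hw] with z hz
    by_cases h0 : w s₀ z = 0
    · rw [h0, hz h0]; simp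
    · field_simp
  rw [h1, integral_mul_div_const G (w s₀), h3]

end Abstract


/-! ## §3 The law square of a frozen-integrand mean is bounded by the mixed path bracket (two-parameter family, E2E) -/

section Square

variable {Z : Type*} [MeasurableSpace Z] {τ : Measure Z}

/-- ★★ **THE LAW SQUARE ≤ sup OF THE MIXED PATH BRACKET** (the (L2ʲ-h) shape).  A TWO-parameter `τ`-density family `w s s′` (think `wNum … t (X(s,s′)) z` over a
coarse one-bond square of law points) with partial families `w₁ = ∂₁w`, `w₂ = ∂₂w`, `w₁₂ = ∂₁∂₂w` on an open `U ⊇ [0,1]` (both parameters): measurability, integrability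
of `w`, `G·w`, `w₂`, `G·w₂` on `[0,1]²`, a.e. dominators of the six families `w₁, G·w₁, w₂, G·w₂, w₁₂, G·w₁₂` on `U²`, a.e. differentiability, non-zero masses on
`[0,1]²`; if the N-form mixed bracket of ★★`hasDerivAt_response_family` is `≤ ℓ` in absolute value on `[0,1]²`, then the second difference of the frozen-integrand
mean `φ(s,s′) = ∫ G·w(s,s′) ∕ ∫ w(s,s′)` over the unit square is `≤ ℓ`. [folklore] -/
theorem abs_normMean_secondDiff_le {w w₁ w₂ w₁₂ : ℝ → ℝ → Z → ℝ} {G : Z → ℝ} {U : Set ℝ} (hU : IsOpen U) (hUI : Icc (0:ℝ) 1 ⊆ U)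
    (hG : AEStronglyMeasurable G τ) (hm : ∀ s s', AEStronglyMeasurable (w s s') τ) (hm₁ : ∀ s s', AEStronglyMeasurable (w₁ s s') τ)
    (hm₂ : ∀ s s', AEStronglyMeasurable (w₂ s s') τ) (hm₁₂ : ∀ s s', AEStronglyMeasurable (w₁₂ s s') τ)
    (hi : ∀ s ∈ Icc (0:ℝ) 1, ∀ s' ∈ Icc (0:ℝ) 1, Integrable (w s s') τ)
    (hiG : ∀ s ∈ Icc (0:ℝ) 1, ∀ s' ∈ Icc (0:ℝ) 1, Integrable (fun z => G z * w s s' z) τ)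
    (hi₂ : ∀ s ∈ Icc (0:ℝ) 1, ∀ s' ∈ Icc (0:ℝ) 1, Integrable (w₂ s s') τ)
    (hiG₂ : ∀ s ∈ Icc (0:ℝ) 1, ∀ s' ∈ Icc (0:ℝ) 1, Integrable (fun z => G z * w₂ s s' z) τ)
    {b₁ : Z → ℝ} (hb₁ : ∀ᵐ z ∂τ, ∀ s ∈ U, ∀ s' ∈ U, |w₁ s s' z| ≤ b₁ z) (hb₁i : Integrable b₁ τ)
    {b₁G : Z → ℝ} (hb₁G : ∀ᵐ z ∂τ, ∀ s ∈ U, ∀ s' ∈ U, |G z * w₁ s s' z| ≤ b₁G z) (hb₁Gi : Integrable b₁G τ)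
    {b₂ : Z → ℝ} (hb₂ : ∀ᵐ z ∂τ, ∀ s ∈ U, ∀ s' ∈ U, |w₂ s s' z| ≤ b₂ z) (hb₂i : Integrable b₂ τ)
    {b₂G : Z → ℝ} (hb₂G : ∀ᵐ z ∂τ, ∀ s ∈ U, ∀ s' ∈ U, |G z * w₂ s s' z| ≤ b₂G z) (hb₂Gi : Integrable b₂G τ)
    {b₁₂ : Z → ℝ} (hb₁₂ : ∀ᵐ z ∂τ, ∀ s ∈ U, ∀ s' ∈ U, |w₁₂ s s' z| ≤ b₁₂ z) (hb₁₂i : Integrable b₁₂ τ)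
    {b₁₂G : Z → ℝ} (hb₁₂G : ∀ᵐ z ∂τ, ∀ s ∈ U, ∀ s' ∈ U, |G z * w₁₂ s s' z| ≤ b₁₂G z) (hb₁₂Gi : Integrable b₁₂G τ)
    (hd₂ : ∀ᵐ z ∂τ, ∀ s ∈ U, ∀ s' ∈ U, HasDerivAt (fun s' => w s s' z) (w₂ s s' z) s')
    (hd₁ : ∀ᵐ z ∂τ, ∀ s ∈ U, ∀ s' ∈ U, HasDerivAt (fun s => w s s' z) (w₁ s s' z) s)
    (hd₁₂ : ∀ᵐ z ∂τ, ∀ s ∈ U, ∀ s' ∈ U, HasDerivAt (fun s => w₂ s s' z) (w₁₂ s s' z) s)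
    (hZ : ∀ s ∈ Icc (0:ℝ) 1, ∀ s' ∈ Icc (0:ℝ) 1, ∫ z, w s s' z ∂τ ≠ 0) {ℓ : ℝ}
    (hb : ∀ s ∈ Icc (0:ℝ) 1, ∀ s' ∈ Icc (0:ℝ) 1,
      |(((∫ z, G z * w₁₂ s s' z ∂τ) / (∫ z, w s s' z ∂τ)
          - ((∫ z, G z * w₂ s s' z ∂τ) / (∫ z, w s s' z ∂τ)) * ((∫ z, w₁ s s' z ∂τ) / (∫ z, w s s' z ∂τ)))
        - ((((∫ z, G z * w₁ s s' z ∂τ) / (∫ z, w s s' z ∂τ)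
              - ((∫ z, G z * w s s' z ∂τ) / (∫ z, w s s' z ∂τ)) * ((∫ z, w₁ s s' z ∂τ) / (∫ z, w s s' z ∂τ)))
            * ((∫ z, w₂ s s' z ∂τ) / (∫ z, w s s' z ∂τ)))
          + ((∫ z, G z * w s s' z ∂τ) / (∫ z, w s s' z ∂τ))
            * ((∫ z, w₁₂ s s' z ∂τ) / (∫ z, w s s' z ∂τ)
              - ((∫ z, w₂ s s' z ∂τ) / (∫ z, w s s' z ∂τ)) * ((∫ z, w₁ s s' z ∂τ) / (∫ z, w s s' z ∂τ)))))| ≤ ℓ) :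
    |(∫ z, G z * w 1 1 z ∂τ) / (∫ z, w 1 1 z ∂τ) - (∫ z, G z * w 1 0 z ∂τ) / (∫ z, w 1 0 z ∂τ)
      - (∫ z, G z * w 0 1 z ∂τ) / (∫ z, w 0 1 z ∂τ) + (∫ z, G z * w 0 0 z ∂τ) / (∫ z, w 0 0 z ∂τ)| ≤ ℓ := by
  refine abs_secondDiff_le_of_mixedDeriv (φ := fun s s' => (∫ z, G z * w s s' z ∂τ) / (∫ z, w s s' z ∂τ))
    (φ₂ := fun s s' => (∫ z, G z * w₂ s s' z ∂τ) / (∫ z, w s s' z ∂τ)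
      - ((∫ z, G z * w s s' z ∂τ) / (∫ z, w s s' z ∂τ)) * ((∫ z, w₂ s s' z ∂τ) / (∫ z, w s s' z ∂τ)))
    (fun s hs s' hs' => ?_) (fun s hs s' hs' => ?_) hb
  · -- the `s′`-response at `(s, s′)`: ✓(L23) `hasDerivAt_normMean` in the second parameter
    have hsU : s ∈ U := hUI hs
    exact hasDerivAt_normMean (w := fun s' => w s s') (w' := fun s' => w₂ s s') (hU.mem_nhds (hUI hs')) hG (fun s' => hm s s')
      (hi s hs s' hs') (hiG s hs s' hs') (hm₂ s s')
      (by filter_upwards [hb₂] with z hz s' hs'; exact hz s hsU s' hs') hb₂i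
      (by filter_upwards [hb₂G] with z hz s' hs'; exact hz s hsU s' hs') hb₂Gi
      (by filter_upwards [hd₂] with z hz s' hs'; exact hz s hsU s' hs') (hZ s hs s' hs')
  · -- its `s`-derivative at `(s, s′)`: §2
    have hs'U : s' ∈ U := hUI hs'
    exact hasDerivAt_response_family (v := fun s => w s s') (v₁ := fun s => w₁ s s') (u := fun s => w₂ s s') (u₁ := fun s => w₁₂ s s')
      (hU.mem_nhds (hUI hs)) hG (fun s => hm s s') (fun s => hm₂ s s') (hm₁ s s') (hm₁₂ s s')
      (hi s hs s' hs') (hiG s hs s' hs') (hi₂ s hs s' hs') (hiG₂ s hs s' hs')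
      (by filter_upwards [hb₁] with z hz s hs; exact hz s hs s' hs'U) hb₁i
      (by filter_upwards [hb₁G] with z hz s hs; exact hz s hs s' hs'U) hb₁Gi
      (by filter_upwards [hb₁₂] with z hz s hs; exact hz s hs s' hs'U) hb₁₂i
      (by filter_upwards [hb₁₂G] with z hz s hs; exact hz s hs s' hs'U) hb₁₂Gi
      (by filter_upwards [hd₁] with z hz s hs; exact hz s hs s' hs'U)
      (by filter_upwards [hd₁₂] with z hz s hs; exact hz s hs s' hs'U) (hZ s hs s' hs')

end Square

end Summit.QuantumFields.YangMills.Theorems.OrganTangentLawSquareResponse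

end
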